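import Summits.AtomisticToContinuum.Crystallization.Theorems.PerronTransitivityNoFractionalGainStubCertificate
import Summits.AtomisticToContinuum.Crystallization.Theorems.ThreeConeCertificateOnePercentCertificateFccRung

/-!
# Crux `PerronTransitivity.NoFractionalGain` (stmt-AtomisticToContinuum-15098), line `merge-perron`:
# the copositive one-centre bound and K* for small clusters

Two unconditional pieces of the crux K* (`2E*·∑cᵢ² ≤ ∑_{i≠j} cᵢcⱼV_LJ(dist xᵢ xⱼ)` for `c ≥ 0`), valid for
ARBITRARY finite configurations (no separation hypothesis — the copositive setting of the open stub
`stub_copositiveKepler`, where repulsive pairs are present and Perron–Frobenius does not apply):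

* `lj_quadForm_ge_of_attractiveRowSum_le` — the COPOSITIVE ONE-CENTRE BOUND: for non-negative weights the
  repulsive part of the kernel may be dropped, so if no site's ATTRACTIVE site sum
  `−∑_{j≠i} min(V_LJ(dist xᵢ xⱼ), 0)` exceeds `Λ`, then `−Λ·∑cᵢ² ≤ ∑_{i≠j} cᵢcⱼV_ij` for all `c ≥ 0`
  (the `w ≡ 1` Collatz–Wielandt certificate `quadForm_le_of_superharmonic_weights` on the attractive part).
  This extends the landed separated one-centre regime (`perronKepler_of_noSuperBoundSite`) to the sliver.
* `noFractionalGain_of_card_le_eighteen` — **K* HOLDS FOR EVERY CLUSTER OF AT MOST 18 POINTS** (all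
  positions, all `c ≥ 0`): `V_LJ ≥ −1/12` everywhere and `∑_{i≠j} cᵢcⱼ ≤ (N − 1)∑cᵢ²` give
  `∑_{i≠j} cᵢcⱼV_ij ≥ −(17/12)∑cᵢ²`, while `2E* ≤ −711/500 < −17/12` by the tree's certified fcc rung
  (`OnePercentFccRung.eStar_le_neg`, twenty shells).  So every violator of K* has at least 19 sites; the
  bound `18 = ⌊12·1.422⌋ + 1` is what the crude pair count buys against the certified `|2E*| ≥ 1.422`.
-/

noncomputable section

namespace Summit.AtomisticToContinuum.Crystallization.Theorems.PerronTransitivity.NoFractionalGain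

open Literature.MathematicalPhysics.StatisticalMechanics
open scoped BigOperators

section General

variable {ι : Type*} [Fintype ι] [DecidableEq ι]

/-- Monotonicity of the off-diagonal quadratic form in the kernel, for non-negative weights. [folklore] -/
theorem quadForm_mono_of_nonneg (V W : ι → ι → ℝ) (c : ι → ℝ) (hc : ∀ i, 0 ≤ c i)
    (hWV : ∀ i j, i ≠ j → W i j ≤ V i j) :
    ∑ i, ∑ j ∈ Finset.univ.erase i, c i * c j * W i j ≤
      ∑ i, ∑ j ∈ Finset.univ.erase i, c i * c j * V i j :=
  Finset.sum_le_sum fun i _ => Finset.sum_le_sum fun j hj =>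
    mul_le_mul_of_nonneg_left (hWV i j (Finset.ne_of_mem_erase hj).symm)
      (mul_nonneg (hc i) (hc j))

/-- Off-diagonal mass bound: `∑_i ∑_{j≠i} cᵢcⱼ = (∑cᵢ)² − ∑cᵢ² ≤ (#ι − 1)·∑cᵢ²` (Cauchy–Schwarz).
[folklore] -/
theorem sum_sum_erase_mul_le (c : ι → ℝ) :
    ∑ i, ∑ j ∈ Finset.univ.erase i, c i * c j ≤ ((Fintype.card ι : ℝ) - 1) * ∑ i, c i ^ 2 := by
  have h1 : ∑ i, ∑ j ∈ Finset.univ.erase i, c i * c j = (∑ i, c i) ^ 2 - ∑ i, c i ^ 2 := by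
    have : ∀ i, ∑ j ∈ Finset.univ.erase i, c i * c j = c i * ∑ j, c j - c i ^ 2 := by
      intro i
      rw [← Finset.mul_sum, ← Finset.add_sum_erase _ _ (Finset.mem_univ i)]
      ring
    simp only [this, Finset.sum_sub_distrib, ← Finset.sum_mul, sq]
  have h2 : (∑ i, c i) ^ 2 ≤ (Fintype.card ι : ℝ) * ∑ i, c i ^ 2 := by
    have := sq_sum_le_card_mul_sum_sq (s := Finset.univ) (f := c)
    simpa using this
  rw [h1]
  linarith

/-- **Copositive bound from a uniform lower bound on the kernel**: if `V i j ≥ −m` off the diagonal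
(`m ≥ 0`) then `−m(#ι − 1)·∑cᵢ² ≤ ∑_{i≠j} cᵢcⱼ V i j` for all `c ≥ 0`. [folklore] -/
theorem quadForm_ge_of_kernel_ge_neg (V : ι → ι → ℝ) (m : ℝ) (hm : 0 ≤ m)
    (hV : ∀ i j, i ≠ j → -m ≤ V i j) (c : ι → ℝ) (hc : ∀ i, 0 ≤ c i) :
    -(m * ((Fintype.card ι : ℝ) - 1)) * ∑ i, c i ^ 2 ≤
      ∑ i, ∑ j ∈ Finset.univ.erase i, c i * c j * V i j := by
  have h1 := quadForm_mono_of_nonneg V (fun _ _ => -m) c hc hV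
  have h2 : ∑ i, ∑ j ∈ Finset.univ.erase i, c i * c j * (-m) =
      -m * ∑ i, ∑ j ∈ Finset.univ.erase i, c i * c j := by
    rw [Finset.mul_sum]
    refine Finset.sum_congr rfl fun i _ => ?_
    rw [Finset.mul_sum]
    exact Finset.sum_congr rfl fun j _ => by ring
  have h3 := sum_sum_erase_mul_le c
  have h4 : -m * (((Fintype.card ι : ℝ) - 1) * ∑ i, c i ^ 2) ≤
      -m * ∑ i, ∑ j ∈ Finset.univ.erase i, c i * c j :=
    mul_le_mul_of_nonpos_left h3 (by linarith)
  rw [h2] at h1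
  linarith

end General

/-! ## The copositive one-centre bound -/

/-- **Copositive one-centre bound for the Lennard-Jones form (any configuration, non-negative weights).**
If no site's attractive site sum exceeds `Λ`, i.e. `−∑_{j≠i} min(V_LJ(dist xᵢ xⱼ), 0) ≤ Λ` at every `i`,
then `−Λ·∑cᵢ² ≤ ∑_{i≠j} cᵢcⱼV_LJ(dist xᵢ xⱼ)` for all `c ≥ 0`: drop the repulsive part (allowed for `c ≥ 0`)
and apply the `w ≡ 1` Collatz–Wielandt certificate to the attractive part. [folklore] -/
theorem lj_quadForm_ge_of_attractiveRowSum_le {N : ℕ} (x : Fin N → EuclideanSpace ℝ (Fin 3)) (Λ : ℝ)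
    (hrow : ∀ i, -∑ j ∈ Finset.univ.erase i, min (lennardJones (dist (x i) (x j))) 0 ≤ Λ)
    (c : Fin N → ℝ) (hc : ∀ i, 0 ≤ c i) :
    -Λ * ∑ i, c i ^ 2 ≤ ∑ i, ∑ j ∈ Finset.univ.erase i, c i * c j * lennardJones (dist (x i) (x j)) := by
  classical
  set W : Fin N → Fin N → ℝ := fun i j => min (lennardJones (dist (x i) (x j))) 0 with hWdef
  set B : Fin N → Fin N → ℝ := fun i j => -W i j with hBdef
  have hB : ∀ i j, 0 ≤ B i j := fun i j => by
    simp only [hBdef, hWdef, Left.nonneg_neg_iff, min_le_iff, le_refl, or_true]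
  have hsymm : ∀ i j, B i j = B j i := fun i j => by
    simp only [hBdef, hWdef, dist_comm]
  have hΛ : ∀ i, ∑ j ∈ Finset.univ.erase i, B i j * (1 : ℝ) ≤ Λ * 1 := by
    intro i
    have : ∑ j ∈ Finset.univ.erase i, B i j * (1 : ℝ) =
        -∑ j ∈ Finset.univ.erase i, min (lennardJones (dist (x i) (x j))) 0 := by
      rw [← Finset.sum_neg_distrib]
      exact Finset.sum_congr rfl fun j _ => by simp only [hBdef, hWdef, mul_one]
    rw [this, mul_one]
    exact hrow i
  have h := quadForm_le_of_superharmonic_weights B hB hsymm (fun _ => 1) (fun _ => one_pos) Λ hΛ c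
  have hre : ∑ i, ∑ j ∈ Finset.univ.erase i, c i * c j * B i j =
      -∑ i, ∑ j ∈ Finset.univ.erase i, c i * c j * W i j := by
    rw [← Finset.sum_neg_distrib]
    refine Finset.sum_congr rfl fun i _ => ?_
    rw [← Finset.sum_neg_distrib]
    exact Finset.sum_congr rfl fun j _ => by simp only [hBdef]; ring
  have hmono := quadForm_mono_of_nonneg (fun i j => lennardJones (dist (x i) (x j))) W c hc
    (fun i j _ => by simp only [hWdef, min_le_iff, le_refl, true_or])
  rw [hre] at h
  linarith

/-! ## K* for clusters of at most 18 points -/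

/-- **No fractional gain for clusters of at most 18 points** (an unconditional instance of the crux
`PerronTransitivity.NoFractionalGain`, stmt-AtomisticToContinuum-15098): for `N ≤ 18`, every `x : Fin N → ℝ³`
(injective or not) and every `c ≥ 0`, `2E*·∑cᵢ² ≤ ∑_{i≠j} cᵢcⱼV_LJ(dist xᵢ xⱼ)`.  Proof: `V_LJ ≥ −1/12`
(`neg_one_div_le_lennardJones`) and `∑_{i≠j} cᵢcⱼ ≤ (N−1)∑cᵢ²` give the right side `≥ −(17/12)∑cᵢ²`, and
`2E* ≤ −711/500 < −17/12` (`OnePercentFccRung.eStar_le_neg`, certified fcc lattice sum). [folklore] -/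
theorem noFractionalGain_of_card_le_eighteen : ∀ (N : ℕ), N ≤ 18 →
    ∀ (x : Fin N → EuclideanSpace ℝ (Fin 3)) (c : Fin N → ℝ), (∀ i, 0 ≤ c i) →
    2 * (⨅ Q : PeriodicConfiguration 3, Q.energyPerParticle lennardJones) * ∑ i, c i ^ 2 ≤
      ∑ i, ∑ j ∈ Finset.univ.erase i, c i * c j * lennardJones (dist (x i) (x j)) := by
  intro N hN x c hc
  classical
  have hE : (⨅ Q : PeriodicConfiguration 3, Q.energyPerParticle lennardJones) ≤ -(711 / 1000) := by
    have h := OnePercentFccRung.eStar_le_neg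
    unfold ChargedEnergyGapNegative.eStar at h
    exact h
  have hker := quadForm_ge_of_kernel_ge_neg (fun i j => lennardJones (dist (x i) (x j))) (1 / 12)
    (by norm_num) (fun i j _ => by
      have := neg_one_div_le_lennardJones (dist (x i) (x j))
      linarith) c hc
  have hcard : (Fintype.card (Fin N) : ℝ) ≤ 18 := by
    rw [Fintype.card_fin]
    exact_mod_cast hN
  have hsq : 0 ≤ ∑ i, c i ^ 2 := Finset.sum_nonneg fun i _ => sq_nonneg (c i)
  have h1 : -((1 : ℝ) / 12 * ((Fintype.card (Fin N) : ℝ) - 1)) ≥ -(17 / 12) := by linarith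
  have h2 : 2 * (⨅ Q : PeriodicConfiguration 3, Q.energyPerParticle lennardJones) ≤
      -((1 : ℝ) / 12 * ((Fintype.card (Fin N) : ℝ) - 1)) := by linarith
  calc 2 * (⨅ Q : PeriodicConfiguration 3, Q.energyPerParticle lennardJones) * ∑ i, c i ^ 2
      ≤ -((1 : ℝ) / 12 * ((Fintype.card (Fin N) : ℝ) - 1)) * ∑ i, c i ^ 2 :=
        mul_le_mul_of_nonneg_right h2 hsq
    _ ≤ ∑ i, ∑ j ∈ Finset.univ.erase i, c i * c j * lennardJones (dist (x i) (x j)) := hker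

end Summit.AtomisticToContinuum.Crystallization.Theorems.PerronTransitivity.NoFractionalGain

end
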